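import Literature.NumberTheory.Kottwitz1984TwistedOrbital.SatakeTransform
import Mathlib.LinearAlgebra.RootSystem.Finite.Nondegenerate
import HarnessLib

/-!
# Kottwitz 1984 (Math. Ann. 269), Lemma 2.3.3 — PROOF of the named fact `SatakeTransform.Lemma233`

R. E. Kottwitz, *Shimura varieties and twisted orbital integrals*, Math. Ann. 269 (1984) 287–300, §2.3 p. 296:
«(2.3.3) Lemma. The following conditions on `p` are equivalent: (a) `⟨p, α^∨⟩ = −1, 0, 1` for all `α ∈ R`. (b) `Σ(p) = W·p`.»
(`p ∈ P(R)` a dominant weight, `Σ(p) = {p' ∈ P(R) : p − p' ∈ Q(R), p ≥ wp' ∀ w ∈ W}`; Kottwitz: «by combining several of the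
exercises (§1, Ex. 23, 24 and §2, Ex. 5d) at the end of Ch. VI of [B], we obtain the lemma»).  The fact is typed in
`Literature/NumberTheory/Kottwitz1984TwistedOrbital/SatakeTransform.lean` (★ `Lemma233 P b p`) for a finite crystallographic root
pairing `P` over ANY linearly ordered commutative ring `R`, with a base `b` (Mathlib `RootPairing.Base`), NOT assumed reduced; this
file proves `theorem Lemma233_holds : Lemma233 P b p` in exactly that generality (no new definition, no new fact).

## Proof (Bourbaki VI §1 ex. 23–24 ∕ Humphreys §13.2–13.4, specialised to minuscule weights)

The tree's root-system layer (`Literature/LinearAlgebra/RootSystem/{MinusculeWeights, SaturatedSetHighestWeight, SmallestSaturatedSet,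
WeylGroupDominantConjugate}`) proves the saturated-set theory over a FIELD of characteristic `0` for REDUCED pairings; since the fact is
stated over an ordered ring and without `IsReduced`, the (small) part of that theory which the minuscule case needs is re-proved here
inline, ring-generally, from Mathlib's `RootPairing.Base` ∕ `RootForm` API:
* §A integer coordinates on the simple roots (`Σ_{j ∈ Δ} f_j α_j`; uniqueness from `Base.linearIndepOn_root`), the cone `C = ℕΔ` and the
  lattice `Q = ℤΦ = ℤΔ`;
* §B `⟨α_j, α_k^∨⟩ ≤ 0` for distinct simple roots (Mathlib `Base.pairingIn_le_zero_of_ne`) ⇒ KEY STEP: if `e ∈ C` and `⟨e, α_k^∨⟩ > 0`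
  then the `α_k`-coordinate of `e` is `≥ 1`, so `e − α_k ∈ C`;
* §C the canonical form `B = P.RootForm` (`W`-invariant, `2B(x, α) = ⟨x, α^∨⟩B(α, α)`, `B(α, α) > 0`, positive definite on the root span
  — Mathlib `rootForm_pos_of_ne_zero`) ⇒ every `e ∈ C ∖ 0` has a simple `α_k` with `⟨e, α_k^∨⟩ > 0`;
* §D the Weyl group: reflections preserve weights and the set of values `⟨x, α^∨⟩`, `wx − x ∈ Q` for weights `x`, and EVERY ROOT
  REFLECTION IS A PRODUCT OF SIMPLE REFLECTIONS (height induction using `Base.IsPos.exists_mem_support_pos_pairingIn`; the case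
  `s_j α < 0 < α`, which would force `α ∈ ℕα_j`, is excluded by `Base.eq_one_or_neg_one_of_mem_support_of_smul_mem`), so a set
  stable under the simple reflections is `W`-stable;
* §E (a) ⇒ `p ≥ wp` for all `w` (the set `{x minuscule : p − x ∈ C}` is stable under simple reflections by §B); (a) ⇒ `Σ(p) ⊆ W·p`
  (for `x ∈ Σ(p)` a conjugate `y` minimising `ht(p − y)` is dominant, and Humphreys' §13.4 Lemma-B descent `z ↦ s_k z = z − α_k`
  inside `W·p` reaches `y`); (b) ⇒ (a) (if `|⟨p, α^∨⟩| ≥ 2` then `p ∓ α ∈ Σ(p) = W·p`, contradicting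
  `B(p ∓ α, p ∓ α) = B(p, p) + (1 ∓ ⟨p, α^∨⟩)B(α, α) < B(p, p)`).

## References
* [Kottwitz1984TwistedOrbital] R. E. Kottwitz, *Shimura varieties and twisted orbital integrals*, Math. Ann. 269 (1984), Lemma 2.3.3 p. 296.
* N. Bourbaki, *Groupes et algèbres de Lie*, Ch. VI §1 ex. 23–24, §2 ex. 5 d) (Kottwitz's source); J. E. Humphreys, *Introduction to Lie
  Algebras and Representation Theory*, §10.2, §13.2 Lemma A, §13.4 Lemma B, Ex. 13.10, 13.13 (the arguments followed here).
-/

namespace Literature.NumberTheory.Kottwitz1984TwistedOrbital.SatakeTransform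

open RootPairing Set Function

variable {ι R M N : Type*} [CommRing R] [AddCommGroup M] [Module R M] [AddCommGroup N] [Module R N]

namespace MinusculeLemma

variable {P : RootPairing ι R M N} (b : P.Base)

/-! ## §A Integer coordinates on the simple roots; the cone `C = ℕΔ` and the lattice `Q = ℤΔ` -/

/-- `C = ℕΔ`: an element of the additive monoid generated by the simple roots is `Σ_{j ∈ Δ} f_j α_j` with integers `f_j ≥ 0`, and
conversely. [cite: Kottwitz1984TwistedOrbital, (2.3.2) (p. 296)] -/
theorem mem_closure_iff_exists_sum {e : M} :
    e ∈ AddSubmonoid.closure (P.root '' (b.support : Set ι)) ↔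
      ∃ f : ι → ℤ, (∀ j ∈ b.support, 0 ≤ f j) ∧ e = ∑ j ∈ b.support, f j • P.root j := by
  classical
  constructor
  · intro he
    refine AddSubmonoid.closure_induction (fun x hx => ?_) ?_ (fun x y _ _ hx hy => ?_) he
    · obtain ⟨j, hj, rfl⟩ := hx
      refine ⟨Pi.single j 1, fun k _ => ?_, ?_⟩
      · by_cases hkj : k = j
        · subst hkj; simp
        · simp [hkj]
      · rw [Finset.sum_eq_single_of_mem j (Finset.mem_coe.mp hj) (fun k _ hkj => by simp [hkj])]
        simp
    · exact ⟨0, fun _ _ => le_rfl, by simp⟩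
    · obtain ⟨f, hf, rfl⟩ := hx
      obtain ⟨g, hg, rfl⟩ := hy
      refine ⟨f + g, fun j hj => add_nonneg (hf j hj) (hg j hj), ?_⟩
      simp [add_smul, Finset.sum_add_distrib]
  · rintro ⟨f, hf, rfl⟩
    refine AddSubmonoid.sum_mem _ fun j hj => ?_
    obtain ⟨n, hn⟩ := Int.eq_ofNat_of_zero_le (hf j hj)
    rw [hn, natCast_zsmul]
    exact AddSubmonoid.nsmul_mem _ (AddSubmonoid.subset_closure (Set.mem_image_of_mem P.root (Finset.mem_coe.mpr hj))) n

/-- `Q = ℤΦ = ℤΔ`: an element of the root lattice is `Σ_{j ∈ Δ} f_j α_j` with integers `f_j`, and conversely.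
[cite: Kottwitz1984TwistedOrbital, §2.3 (p. 296)] -/
theorem mem_rootSpan_int_iff_exists_sum {e : M} :
    e ∈ P.rootSpan ℤ ↔ ∃ f : ι → ℤ, e = ∑ j ∈ b.support, f j • P.root j := by
  classical
  rw [RootPairing.rootSpan, ← b.span_int_root_support]
  constructor
  · intro he
    rw [image_eq_range, Submodule.mem_span_range_iff_exists_fun] at he
    obtain ⟨c, hc⟩ := he
    simp only [Finset.coe_sort_coe] at hc
    refine ⟨fun j => if hj : j ∈ b.support then c ⟨j, hj⟩ else 0, ?_⟩
    rw [← hc, ← Finset.sum_coe_sort b.support]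
    refine Finset.sum_congr rfl fun j _ => ?_
    simp [j.2]
  · rintro ⟨f, rfl⟩
    exact Submodule.sum_mem _ fun j hj => Submodule.smul_of_tower_mem _ _ (Submodule.subset_span ⟨j, hj, rfl⟩)

/-- The cone lies in the root lattice: `ℕΔ ⊆ ℤΦ`. [cite: Kottwitz1984TwistedOrbital, §2.3 (p. 296)] -/
theorem mem_rootSpan_int_of_mem_closure {e : M} (he : e ∈ AddSubmonoid.closure (P.root '' (b.support : Set ι))) :
    e ∈ P.rootSpan ℤ := by
  obtain ⟨f, -, rfl⟩ := (mem_closure_iff_exists_sum b).mp he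
  exact (mem_rootSpan_int_iff_exists_sum b).mpr ⟨f, rfl⟩

/-- The cone lies in the `R`-span of the roots. [cite: Kottwitz1984TwistedOrbital, §2.3 (p. 296)] -/
theorem mem_rootSpan_of_mem_closure {e : M} (he : e ∈ AddSubmonoid.closure (P.root '' (b.support : Set ι))) :
    e ∈ P.rootSpan R := by
  obtain ⟨f, -, rfl⟩ := (mem_closure_iff_exists_sum b).mp he
  exact Submodule.sum_mem _ fun j _ => Submodule.smul_of_tower_mem _ _ (Submodule.subset_span (mem_range_self j))

/-- UNIQUENESS OF COORDINATES: the simple roots are linearly independent (over `R`, hence over `ℤ`).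
[cite: Kottwitz1984TwistedOrbital, §2.3 (p. 296)] -/
theorem eq_of_sum_eq_sum [CharZero R] {f g : ι → ℤ}
    (h : ∑ j ∈ b.support, f j • P.root j = ∑ j ∈ b.support, g j • P.root j) :
    ∀ j ∈ b.support, f j = g j := by
  intro j hj
  rw [b.support.sum_subtype (p := (· ∈ b.support)) (by simp) (F := inferInstance),
    b.support.sum_subtype (p := (· ∈ b.support)) (by simp) (F := inferInstance)] at h
  have aux (k : b.support) := Fintype.linearIndependent_iffₛ.mp
      (b.linearIndepOn_root.restrict_scalars' ℤ) (f ∘ (↑)) (g ∘ (↑)) (by simpa using h) k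
  simpa using aux ⟨j, hj⟩

/-- The coordinates of `0` vanish. [cite: Kottwitz1984TwistedOrbital, §2.3 (p. 296)] -/
theorem eq_zero_of_sum_eq_zero [CharZero R] {f : ι → ℤ} (h : ∑ j ∈ b.support, f j • P.root j = 0) :
    ∀ j ∈ b.support, f j = 0 := by
  have h' : ∑ j ∈ b.support, f j • P.root j = ∑ j ∈ b.support, (0 : ι → ℤ) j • P.root j := by simpa using h
  exact eq_of_sum_eq_sum b h'

/-- Changing one coordinate: `Σ_l (f + c·δ_j)_l α_l = Σ_l f_l α_l + c α_j`. [cite: Kottwitz1984TwistedOrbital, §2.3 (p. 296)] -/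
theorem sum_update_smul_root [DecidableEq ι] (f : ι → ℤ) {j : ι} (hj : j ∈ b.support) (c : ℤ) :
    ∑ l ∈ b.support, Function.update f j (f j + c) l • P.root l = (∑ l ∈ b.support, f l • P.root l) + c • P.root j := by
  rw [← Finset.add_sum_erase _ _ hj, ← Finset.add_sum_erase _ (fun l => f l • P.root l) hj]
  simp only [Function.update_self, add_smul]
  have : ∑ l ∈ b.support.erase j, Function.update f j (f j + c) l • P.root l = ∑ l ∈ b.support.erase j, f l • P.root l :=
    Finset.sum_congr rfl fun l hl => by rw [Function.update_of_ne (Finset.mem_erase.mp hl).1]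
  rw [this]; abel

/-- Changing one coordinate changes the height `Σ_l f_l` accordingly. [cite: Kottwitz1984TwistedOrbital, §2.3 (p. 296)] -/
theorem sum_update_eq [DecidableEq ι] (f : ι → ℤ) {j : ι} (hj : j ∈ b.support) (c : ℤ) :
    ∑ l ∈ b.support, Function.update f j (f j + c) l = (∑ l ∈ b.support, f l) + c := by
  rw [← Finset.add_sum_erase _ _ hj, ← Finset.add_sum_erase _ f hj]
  simp only [Function.update_self]
  have : ∑ l ∈ b.support.erase j, Function.update f j (f j + c) l = ∑ l ∈ b.support.erase j, f l :=
    Finset.sum_congr rfl fun l hl => by rw [Function.update_of_ne (Finset.mem_erase.mp hl).1]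
  rw [this]; abel

/-! ## §B Pairings with the simple coroots -/

/-- `⟨Σ_j f_j α_j, α_i^∨⟩ = Σ_j f_j ⟨α_j, α_i^∨⟩`, an integer for a crystallographic pairing.
[cite: Kottwitz1984TwistedOrbital, §2.3 (p. 296)] -/
theorem coroot'_sum_eq_cast [P.IsCrystallographic] (f : ι → ℤ) (i : ι) :
    P.coroot' i (∑ j ∈ b.support, f j • P.root j) = ((∑ j ∈ b.support, f j * P.pairingIn ℤ j i : ℤ) : R) := by
  simp only [map_sum, map_zsmul, root_coroot'_eq_pairing, Int.cast_sum, Int.cast_mul, zsmul_eq_mul]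
  refine Finset.sum_congr rfl fun j _ => ?_
  rw [← P.algebraMap_pairingIn ℤ j i, eq_intCast]

/-- The diagonal bound `Σ_j f_j ⟨α_j, α_i^∨⟩ ≤ 2 f_i` for non-negative coordinates (`⟨α_j, α_i^∨⟩ ≤ 0` off the diagonal, `= 2` on it).
[cite: Kottwitz1984TwistedOrbital, §2.3 (p. 296)] -/
theorem sum_mul_pairingIn_le [CharZero R] [IsDomain R] [Finite ι] [P.IsCrystallographic] {f : ι → ℤ}
    (hf : ∀ j ∈ b.support, 0 ≤ f j) {i : ι} (hi : i ∈ b.support) :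
    ∑ j ∈ b.support, f j * P.pairingIn ℤ j i ≤ 2 * f i := by
  classical
  rw [← Finset.add_sum_erase _ _ hi]
  have hii : P.pairingIn ℤ i i = 2 := by
    apply FaithfulSMul.algebraMap_injective ℤ R
    rw [P.algebraMap_pairingIn ℤ, P.pairing_same, map_ofNat]
  rw [hii, mul_comm]
  have : ∑ j ∈ b.support.erase i, f j * P.pairingIn ℤ j i ≤ 0 := by
    refine Finset.sum_nonpos fun j hj => ?_
    obtain ⟨hji, hj'⟩ := Finset.mem_erase.mp hj
    exact mul_nonpos_of_nonneg_of_nonpos (hf j hj') (b.pairingIn_le_zero_of_ne hji hj' hi)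
  linarith

/-- KEY STEP (Humphreys §13.4, proof of Lemma B: «it is now possible to subtract `β` once from `μ'` without leaving `Π`»): if `e ∈ C` pairs
POSITIVELY with a simple coroot `α_i^∨`, then its `α_i`-coordinate is `≥ 1`. [cite: Kottwitz1984TwistedOrbital, §2.3 (p. 296)] -/
theorem one_le_of_coroot'_pos [LinearOrder R] [IsStrictOrderedRing R] [Finite ι]
    [P.IsCrystallographic] {f : ι → ℤ} (hf : ∀ j ∈ b.support, 0 ≤ f j) {i : ι} (hi : i ∈ b.support)
    (hpos : 0 < P.coroot' i (∑ j ∈ b.support, f j • P.root j)) : 1 ≤ f i := by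
  rw [coroot'_sum_eq_cast b, Int.cast_pos] at hpos
  have := sum_mul_pairingIn_le b hf hi
  omega

/-- Consequently `e − α_i ∈ C` whenever `e ∈ C` and `⟨e, α_i^∨⟩ > 0` (`α_i` simple). [cite: Kottwitz1984TwistedOrbital, §2.3 (p. 296)] -/
theorem sub_root_mem_closure_of_coroot'_pos [LinearOrder R] [IsStrictOrderedRing R] [Finite ι]
    [P.IsCrystallographic] {e : M} (he : e ∈ AddSubmonoid.closure (P.root '' (b.support : Set ι))) {i : ι}
    (hi : i ∈ b.support) (hpos : 0 < P.coroot' i e) :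
    e - P.root i ∈ AddSubmonoid.closure (P.root '' (b.support : Set ι)) := by
  classical
  obtain ⟨f, hf, rfl⟩ := (mem_closure_iff_exists_sum b).mp he
  have h1 := one_le_of_coroot'_pos b hf hi hpos
  refine (mem_closure_iff_exists_sum b).mpr ⟨Function.update f i (f i + (-1)), fun j hj => ?_, ?_⟩
  · by_cases hji : j = i
    · subst hji; simp only [Function.update_self]; omega
    · simp only [Function.update_of_ne hji]; exact hf j hj
  · rw [sum_update_smul_root b f hi, neg_one_zsmul, sub_eq_add_neg]

/-! ## §C The canonical invariant form `B = P.RootForm` -/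

/-- `2B(x, α_i) = ⟨x, α_i^∨⟩ B(α_i, α_i)` (SGA3 XXI 1.2.1 (10), Mathlib `rootForm_self_smul_coroot`, read through the pairing).
[cite: Kottwitz1984TwistedOrbital, §2.3 (p. 296)] -/
theorem two_mul_rootForm_root [Fintype ι] (x : M) (i : ι) :
    2 * P.RootForm x (P.root i) = P.coroot' i x * P.RootForm (P.root i) (P.root i) := by
  have h := congr_arg (P.toLinearMap x) (P.rootForm_self_smul_coroot i)
  rw [map_smul, map_nsmul, toLinearMap_apply_apply_Polarization, smul_eq_mul, nsmul_eq_mul, Nat.cast_ofNat] at h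
  have hs : P.RootForm (P.root i) x = P.RootForm x (P.root i) := by
    simp only [rootForm_apply_apply, mul_comm]
  have h' : P.RootForm (P.root i) (P.root i) * P.coroot' i x = 2 * P.RootForm x (P.root i) := by
    rw [← hs]; exact h
  linear_combination -h'

/-- `B(α, α) > 0` for every root (ordered coefficients). [cite: Kottwitz1984TwistedOrbital, §2.3 (p. 296)] -/
theorem rootForm_root_self_pos [LinearOrder R] [IsStrictOrderedRing R] [Fintype ι] (i : ι) :
    0 < P.RootForm (P.root i) (P.root i) :=
  P.rootForm_pos_of_ne_zero (Submodule.subset_span (mem_range_self i)) (P.ne_zero i)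

/-- `B` is `W`-invariant. [cite: Kottwitz1984TwistedOrbital, §2.3 (p. 296)] -/
theorem rootForm_smul_smul [Fintype ι] {g : Aut P} (hg : g ∈ P.weylGroup) (x y : M) :
    P.RootForm (g • x) (g • y) = P.RootForm x y := by
  induction hg using weylGroup.induction generalizing x y with
  | mem i => simp [rootForm_reflection_reflection_apply]
  | one => simp
  | mul g₁ g₂ _ _ ih₁ ih₂ => rw [mul_smul, mul_smul, ih₁, ih₂]

/-- Humphreys' step «from `(Σ k_α α, Σ k_α α) > 0` we deduce that `(Σ k_α α, β) > 0` for some `β ∈ Δ` with `k_β > 0`», here as: every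
non-zero `e ∈ C` pairs positively with some SIMPLE coroot (positivity of `B` on the root span, Mathlib `rootForm_pos_of_ne_zero`).
[cite: Kottwitz1984TwistedOrbital, §2.3 (p. 296)] -/
theorem exists_mem_support_coroot'_pos [LinearOrder R] [IsStrictOrderedRing R] [Fintype ι] {e : M}
    (he : e ∈ AddSubmonoid.closure (P.root '' (b.support : Set ι))) (hne : e ≠ 0) :
    ∃ i ∈ b.support, 0 < P.coroot' i e := by
  by_contra! hle
  have hpos : 0 < P.RootForm e e := P.rootForm_pos_of_ne_zero (mem_rootSpan_of_mem_closure b he) hne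
  obtain ⟨f, hf, hfe⟩ := (mem_closure_iff_exists_sum b).mp he
  have hee : P.RootForm e e = P.RootForm e (∑ j ∈ b.support, f j • P.root j) := by rw [← hfe]
  have hexp : 2 * P.RootForm e e = ∑ j ∈ b.support, (f j : R) * (P.coroot' j e * P.RootForm (P.root j) (P.root j)) := by
    rw [hee, map_sum, Finset.mul_sum]
    refine Finset.sum_congr rfl fun j _ => ?_
    rw [map_zsmul, zsmul_eq_mul, mul_left_comm, two_mul_rootForm_root]
  have : ∑ j ∈ b.support, (f j : R) * (P.coroot' j e * P.RootForm (P.root j) (P.root j)) ≤ 0 :=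
    Finset.sum_nonpos fun j hj => mul_nonpos_of_nonneg_of_nonpos (Int.cast_nonneg (hf j hj))
      (mul_nonpos_of_nonpos_of_nonneg (hle j hj) (rootForm_root_self_pos j).le)
  linarith

/-! ## §D The Weyl group: reflections, weights, and generation by the simple reflections -/

/-- The values `⟨wx, α^∨⟩`, `α ∈ Φ`, are among the values `⟨x, α^∨⟩` (`⟨s_j x, α_i^∨⟩ = ⟨x, (s_j α_i)^∨⟩`): a property of all
pairings of `x` with coroots passes to `wx`. [cite: Kottwitz1984TwistedOrbital, §2.3 (p. 296)] -/
theorem forall_coroot'_smul {Q : R → Prop} {g : Aut P} (hg : g ∈ P.weylGroup) {x : M} (hx : ∀ i, Q (P.coroot' i x)) :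
    ∀ i, Q (P.coroot' i (g • x)) := by
  induction hg using weylGroup.induction generalizing x with
  | mem j => intro i; rw [Equiv.reflection_smul, coroot'_reflection]; exact hx _
  | one => simpa using hx
  | mul g₁ g₂ _ _ ih₁ ih₂ => rw [mul_smul]; exact ih₁ (ih₂ hx)

/-- Weights go to weights under `W`. [cite: Kottwitz1984TwistedOrbital, §2.3 (p. 296)] -/
theorem isWeight_smul {g : Aut P} (hg : g ∈ P.weylGroup) {x : M} (hx : IsWeight P x) : IsWeight P (g • x) :=
  forall_coroot'_smul (P := P) (Q := fun r : R => ∃ n : ℤ, r = (n : R)) hg (fun i => hx i)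

/-- `wx − x ∈ Q` for a weight `x` (`s_α x − x = −⟨x, α^∨⟩α`). [cite: Kottwitz1984TwistedOrbital, §2.3 (p. 296)] -/
theorem smul_sub_mem_rootSpan_int {g : Aut P} (hg : g ∈ P.weylGroup) {x : M} (hx : IsWeight P x) :
    g • x - x ∈ P.rootSpan ℤ := by
  induction hg using weylGroup.induction generalizing x with
  | mem j =>
    obtain ⟨n, hn⟩ := hx j
    rw [Equiv.reflection_smul, reflection_apply, sub_sub_cancel_left, ← neg_smul]
    change -(P.toLinearMap x (P.coroot j)) • P.root j ∈ P.rootSpan ℤ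
    rw [hn, ← Int.cast_neg, Int.cast_smul_eq_zsmul]
    exact Submodule.smul_mem _ _ (Submodule.subset_span (mem_range_self j))
  | one => simp
  | mul g₁ g₂ _ hg₂ ih₁ ih₂ =>
    have : (g₁ * g₂) • x - x = (g₁ • (g₂ • x) - g₂ • x) + (g₂ • x - x) := by rw [mul_smul]; abel
    rw [this]
    exact Submodule.add_mem _ (ih₁ (isWeight_smul hg₂ hx)) (ih₂ hx)

/-- EVERY ROOT REFLECTION IS A PRODUCT OF SIMPLE REFLECTIONS (Humphreys §10.2 Cor. of Lemma A, §10.3 Thm. (c)–(d)), in the form used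
below: a set of weights stable under the SIMPLE reflections is stable under all root reflections.  Positive roots by induction on the
height: for `α > 0` not simple there is a simple `α_j` with `⟨α, α_j^∨⟩ > 0` (Mathlib `IsPos.exists_mem_support_pos_pairingIn`), `β = s_j α`
has smaller height and `s_α = s_j s_β s_j`; `β < 0` would force `α ∈ ℕα_j`, excluded by Mathlib's
`Base.eq_one_or_neg_one_of_mem_support_of_smul_mem`; finally `s_{−α} = s_α`. [cite: Kottwitz1984TwistedOrbital, §2.3 (p. 296)] -/
theorem reflection_mem_of_forall_mem_support [CharZero R] [IsDomain R] [Finite ι] [P.IsCrystallographic]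
    (S : Set M) (hS : ∀ j ∈ b.support, ∀ x ∈ S, P.reflection j x ∈ S) (i : ι) : ∀ x ∈ S, P.reflection i x ∈ S := by
  classical
  have : Module.IsReflexive R M := .of_isPerfPair P.toLinearMap
  have : IsAddTorsionFree M := .of_isTorsionFree R M
  have : Module.IsReflexive R N := .of_isPerfPair P.flip.toLinearMap
  have : IsAddTorsionFree N := .of_isTorsionFree R N
  -- conjugation: `s_{s_j α} = s_j s_α s_j`, read on vectors
  have hconj : ∀ (j l : ι) (x : M),
      P.reflection l x = P.reflection j (P.reflection (P.reflectionPerm j l) (P.reflection j x)) := fun j l x => by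
    rw [P.reflection_reflectionPerm]; simp [LinearEquiv.mul_apply]
  -- positive roots, by strong induction on the height
  have hpos : ∀ n : ℕ, ∀ i : ι, b.height i = n → ∀ x ∈ S, P.reflection i x ∈ S := by
    intro n
    induction n using Nat.strong_induction_on with
    | _ n ih =>
    intro i hin x hx
    by_cases hmem : i ∈ b.support
    · exact hS i hmem x hx
    have hn : 0 < n := by
      have := b.height_ne_zero i; omega
    have hi : b.IsPos i := b.isPos_iff.mpr (by omega)
    obtain ⟨j, hj, hji⟩ := hi.exists_mem_support_pos_pairingIn
    have hij : 0 < P.pairingIn ℤ i j := (P.zero_lt_pairingIn_iff' ℤ).mp hji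
    set z := P.pairingIn ℤ i j with hz
    set k := P.reflectionPerm j i with hk
    have hrootk : P.root k = P.root i + (-z) • P.root j := by
      rw [hk, root_reflectionPerm, reflection_apply_root, ← P.algebraMap_pairingIn ℤ i j, eq_intCast, Int.cast_smul_eq_zsmul,
        neg_smul, sub_eq_add_neg]
    have hhk : b.height k = n - z := by
      rw [b.height_add_zsmul hrootk, hin, b.height_one_of_mem_support hj, smul_eq_mul, mul_one]; ring
    rcases lt_or_gt_of_ne (b.height_ne_zero k) with hneg | hposk
    · -- impossible: `s_j α_i < 0 < α_i` with `α_i` not a multiple of `α_j`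
      exfalso
      obtain ⟨f, hf₀, hf₁, hf₂⟩ := b.exists_root_eq_sum_int i
      have hf : 0 ≤ f := by
        rcases hf₁ with h | h
        · exact h.le
        · exfalso
          have : b.height i ≤ 0 := by
            rw [b.height_eq_sum hf₂]; exact Finset.sum_nonpos fun l _ => h.le l
          omega
      set g : ι → ℤ := Function.update f j (f j + (-z)) with hg
      have hgsum : ∑ l ∈ b.support, g l • P.root l = P.root k := by
        rw [hg, sum_update_smul_root b f hj, ← hf₂, hrootk]
      have hg₀ : g.support ⊆ b.support := by
        intro l hl
        by_cases hlj : l = j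
        · exact hlj ▸ hj
        · exact hf₀ (by simpa [hg, Function.update_of_ne hlj] using hl)
      have hgle : g ≤ 0 := by
        rcases b.pos_or_neg_of_sum_smul_root_mem g (hgsum ▸ mem_range_self k) hg₀ with h | h
        · exfalso
          have : 0 ≤ b.height k := by
            rw [b.height_eq_sum hgsum.symm]; exact Finset.sum_nonneg fun l _ => h.le l
          omega
        · exact h.le
      have hfz : ∀ l ∈ b.support, l ≠ j → f l = 0 := by
        intro l hl hlj
        have h1 : g l ≤ 0 := hgle l
        rw [hg, Function.update_of_ne hlj] at h1
        exact le_antisymm h1 (hf l)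
      have hroot : P.root i = ((f j : ℤ) : R) • P.root j := by
        rw [hf₂, Finset.sum_eq_single_of_mem j hj (fun l hl hlj => by rw [hfz l hl hlj, zero_smul]), Int.cast_smul_eq_zsmul]
      rcases b.eq_one_or_neg_one_of_mem_support_of_smul_mem j hj (f j : R) (hroot ▸ mem_range_self i) with h1 | h1
      · rw [h1, one_smul] at hroot
        exact hmem (P.root.injective hroot ▸ hj)
      · have h2 : f j = -1 := by exact_mod_cast h1
        have h3 : 0 ≤ f j := hf j
        omega
    · -- `β = s_j α > 0` has smaller height: induction, then conjugate back
      have hkn : (b.height k).toNat < n := by omega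
      have hk' : b.height k = ((b.height k).toNat : ℕ) := (Int.toNat_of_nonneg hposk.le).symm
      rw [hconj j i x]
      exact hS j hj _ (ih _ hkn k hk' _ (hS j hj x hx))
  -- all roots: `s_{−α} = s_α`
  intro x hx
  rcases lt_or_gt_of_ne (b.height_ne_zero i) with hneg | hposi
  · have hroot : P.root (P.reflectionPerm i i) = P.root i + (-2 : ℤ) • P.root i := by
      rw [root_reflectionPerm, reflection_apply_self]; module
    have hh : b.height (P.reflectionPerm i i) = -b.height i := by
      rw [b.height_add_zsmul hroot]; ring
    have h' : b.height (P.reflectionPerm i i) = ((-b.height i).toNat : ℕ) := by rw [hh]; omega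
    have key : P.reflection (P.reflectionPerm i i) x = P.reflection i x := by
      have h := hconj i i (P.reflection i x)
      simp only [reflection_same] at h
      simpa using (congr_arg (P.reflection i) h).symm
    rw [← key]
    exact hpos _ _ h' x hx
  · exact hpos _ i (Int.toNat_of_nonneg hposi.le).symm x hx

/-- Hence a set stable under the simple reflections is `W`-stable. [cite: Kottwitz1984TwistedOrbital, §2.3 (p. 296)] -/
theorem smul_mem_of_forall_mem_support [CharZero R] [IsDomain R] [Finite ι] [P.IsCrystallographic]
    (S : Set M) (hS : ∀ j ∈ b.support, ∀ x ∈ S, P.reflection j x ∈ S) {g : Aut P} (hg : g ∈ P.weylGroup) :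
    ∀ x ∈ S, g • x ∈ S := by
  induction hg using weylGroup.induction with
  | mem i => intro x hx; simpa using reflection_mem_of_forall_mem_support b S hS i x hx
  | one => intro x hx; simpa using hx
  | mul g₁ g₂ _ _ ih₁ ih₂ => intro x hx; rw [mul_smul]; exact ih₁ _ (ih₂ _ hx)

/-! ## §E The three implications -/

section Ordered

variable [LinearOrder R] [IsStrictOrderedRing R] [P.IsCrystallographic]

/-- **(a) ⇒ `p ≥ wp` for all `w ∈ W`** (Humphreys §13.2 Lemma A in the minuscule case): for a dominant `p` with all `⟨p, α^∨⟩ ∈ {−1, 0, 1}`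
the set `{x : ⟨x, α^∨⟩ ∈ {−1, 0, 1} ∀α, p − x ∈ ℕΔ}` contains `p` and is stable under the simple reflections (§B), hence under `W` (§D).
[cite: Kottwitz1984TwistedOrbital, Lemma 2.3.3 (p. 296)] -/
theorem sub_smul_mem_closure_of_minuscule [Finite ι] {p : M} (hp : IsDominant P b p)
    (ha : ∀ i, P.coroot' i p ∈ ({-1, 0, 1} : Set R)) {g : Aut P} (hg : g ∈ P.weylGroup) :
    p - g • p ∈ AddSubmonoid.closure (P.root '' (b.support : Set ι)) := by
  set S : Set M := {x | (∀ i, P.coroot' i x ∈ ({-1, 0, 1} : Set R)) ∧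
    p - x ∈ AddSubmonoid.closure (P.root '' (b.support : Set ι))} with hSdef
  have hS : ∀ j ∈ b.support, ∀ x ∈ S, P.reflection j x ∈ S := by
    intro j hj x hx
    obtain ⟨hx, hpx⟩ := hx
    refine ⟨fun i => ?_, ?_⟩
    · rw [coroot'_reflection]; exact hx _
    · have hrw : p - P.reflection j x = (p - x) + P.coroot' j x • P.root j := by rw [reflection_apply]; abel
      rw [hrw]
      have hxj := hx j
      simp only [Set.mem_insert_iff, Set.mem_singleton_iff] at hxj
      rcases hxj with h | h | h
      · rw [h, neg_one_smul, ← sub_eq_add_neg]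
        refine sub_root_mem_closure_of_coroot'_pos b hpx hj ?_
        have h0 : (0 : R) ≤ P.coroot' j p := hp j hj
        rw [map_sub, h]; linarith
      · rw [h, zero_smul, add_zero]; exact hpx
      · rw [h, one_smul]
        exact AddSubmonoid.add_mem _ hpx (AddSubmonoid.subset_closure (Set.mem_image_of_mem P.root (Finset.mem_coe.mpr hj)))
  have hpS : p ∈ S := ⟨ha, by rw [sub_self]; exact AddSubmonoid.zero_mem _⟩
  exact (smul_mem_of_forall_mem_support b S hS hg p hpS).2

/-- **Humphreys' §13.4 Lemma-B descent inside the orbit of a minuscule weight**: if `y` is dominant and some `z ∈ W·p` has `z − y ∈ ℕΔ`, then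
`y ∈ W·p` (induction on `ht(z − y)`: for `z ≠ y`, §C gives a simple `α_k` with `⟨z − y, α_k^∨⟩ > 0`, so `⟨z, α_k^∨⟩ = 1`,
`s_k z = z − α_k ∈ W·p` and `(z − α_k) − y ∈ ℕΔ` by §B). [cite: Kottwitz1984TwistedOrbital, Lemma 2.3.3 (p. 296)] -/
theorem exists_smul_eq_of_descent [Fintype ι] {p : M} (ha : ∀ i, P.coroot' i p ∈ ({-1, 0, 1} : Set R)) {y : M}
    (hy : ∀ j ∈ b.support, 0 ≤ P.coroot' j y) :
    ∀ (n : ℕ) (z : M), (∃ g ∈ P.weylGroup, g • p = z) →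
      ∀ f : ι → ℤ, (∀ j ∈ b.support, 0 ≤ f j) → z - y = ∑ j ∈ b.support, f j • P.root j →
        ∑ j ∈ b.support, f j = n → ∃ g ∈ P.weylGroup, g • p = y := by
  classical
  intro n
  induction n with
  | zero =>
    intro z hz f hf hzy hsum
    have hf0 : ∀ j ∈ b.support, f j = 0 :=
      (Finset.sum_eq_zero_iff_of_nonneg hf).mp (by exact_mod_cast hsum)
    have : z - y = 0 := by
      rw [hzy]; exact Finset.sum_eq_zero fun j hj => by rw [hf0 j hj, zero_smul]
    rw [sub_eq_zero] at this
    exact this ▸ hz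
  | succ n ih =>
    intro z hz f hf hzy hsum
    obtain ⟨g, hg, hgz⟩ := hz
    have he : z - y ∈ AddSubmonoid.closure (P.root '' (b.support : Set ι)) :=
      (mem_closure_iff_exists_sum b).mpr ⟨f, hf, hzy⟩
    have hne : z - y ≠ 0 := by
      intro h0
      rw [h0] at hzy
      have := eq_zero_of_sum_eq_zero b hzy.symm
      rw [Finset.sum_eq_zero fun j hj => this j hj] at hsum
      exact absurd hsum (by norm_cast)
    obtain ⟨k, hk, hkpos⟩ := exists_mem_support_coroot'_pos b he hne
    -- `⟨z, α_k^∨⟩ = 1`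
    have hzk : P.coroot' k z = 1 := by
      have hmem : P.coroot' k z ∈ ({-1, 0, 1} : Set R) := by
        rw [← hgz]; exact forall_coroot'_smul (Q := fun r : R => r ∈ ({-1, 0, 1} : Set R)) hg ha k
      have hzpos : 0 < P.coroot' k z := by
        have h0 := hy k hk
        rw [map_sub] at hkpos; linarith
      simp only [Set.mem_insert_iff, Set.mem_singleton_iff] at hmem
      rcases hmem with h | h | h
      · rw [h] at hzpos; linarith
      · rw [h] at hzpos; exact absurd hzpos (lt_irrefl 0)
      · exact h
    -- the next point of the descent
    have hz' : P.reflection k z = z - P.root k := by rw [reflection_apply, hzk, one_smul]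
    have h1 : 1 ≤ f k := one_le_of_coroot'_pos b hf hk (hzy ▸ hkpos)
    refine ih (P.reflection k z) ⟨Equiv.reflection P k * g, mul_mem (P.reflection_mem_weylGroup k) hg,
      by rw [mul_smul, hgz, Equiv.reflection_smul]⟩ (Function.update f k (f k + (-1))) (fun j hj => ?_) ?_ ?_
    · by_cases hjk : j = k
      · subst hjk; simp only [Function.update_self]; omega
      · simp only [Function.update_of_ne hjk]; exact hf j hj
    · rw [sum_update_smul_root b f hk, ← hzy, hz', neg_one_zsmul]; abel
    · rw [sum_update_eq b f hk, hsum]; push_cast; ring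

/-- **(a) ⇒ `Σ(p) ⊆ W·p`**: for `x ∈ Σ(p)` pick a conjugate `y = w₀x` minimising `ht(p − y)`; then `y` is dominant (else `s_j y` has smaller
height), and the Lemma-B descent from `z = p` shows `y ∈ W·p`. [cite: Kottwitz1984TwistedOrbital, Lemma 2.3.3 (p. 296)] -/
theorem exists_smul_eq_of_mem_sigmaSet [Fintype ι] {p : M} (ha : ∀ i, P.coroot' i p ∈ ({-1, 0, 1} : Set R))
    {x : M} (hx : x ∈ SigmaSet P b p) : ∃ g ∈ P.weylGroup, g • p = x := by
  classical
  obtain ⟨hxw, -, hxC⟩ := hx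
  have hxC' : ∀ g ∈ P.weylGroup, p - g • x ∈ AddSubmonoid.closure (P.root '' (b.support : Set ι)) :=
    fun g hg => hxC ⟨g, hg⟩
  -- heights of the `p − wx`
  let Q : ℕ → Prop := fun n => ∃ g ∈ P.weylGroup, ∃ f : ι → ℤ, (∀ j ∈ b.support, 0 ≤ f j) ∧
    p - g • x = ∑ j ∈ b.support, f j • P.root j ∧ ∑ j ∈ b.support, f j = n
  have hQ : ∃ n, Q n := by
    obtain ⟨f, hf, hfe⟩ := (mem_closure_iff_exists_sum b).mp (hxC' 1 (one_mem _))
    refine ⟨(∑ j ∈ b.support, f j).toNat, 1, one_mem _, f, hf, hfe, ?_⟩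
    rw [Int.toNat_of_nonneg (Finset.sum_nonneg hf)]
  obtain ⟨w₀, hw₀, f₀, hf₀, hpy, hsum⟩ := Nat.find_spec hQ
  set y := w₀ • x with hydef
  -- `y` is dominant, by minimality
  have hy : ∀ j ∈ b.support, 0 ≤ P.coroot' j y := by
    intro j hj
    by_contra! hneg
    obtain ⟨m, hm⟩ := isWeight_smul hw₀ hxw j
    change P.coroot' j y = (m : R) at hm
    have hm0 : m < 0 := by rw [hm] at hneg; exact_mod_cast hneg
    have hw₁ : Equiv.reflection P j * w₀ ∈ P.weylGroup := mul_mem (P.reflection_mem_weylGroup j) hw₀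
    have hpy₁ : p - (Equiv.reflection P j * w₀) • x = ∑ l ∈ b.support, Function.update f₀ j (f₀ j + m) l • P.root l := by
      rw [sum_update_smul_root b f₀ hj, ← hpy, mul_smul, ← hydef, Equiv.reflection_smul, reflection_apply, hm,
        Int.cast_smul_eq_zsmul]
      abel
    obtain ⟨f₁, hf₁, hpy₁'⟩ := (mem_closure_iff_exists_sum b).mp (hxC' _ hw₁)
    have hff : ∀ l ∈ b.support, f₁ l = Function.update f₀ j (f₀ j + m) l := eq_of_sum_eq_sum b (hpy₁'.symm.trans hpy₁)
    have hnn : ∀ l ∈ b.support, 0 ≤ Function.update f₀ j (f₀ j + m) l := fun l hl => hff l hl ▸ hf₁ l hl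
    have hsum₁ : ∑ l ∈ b.support, Function.update f₀ j (f₀ j + m) l = Nat.find hQ + m := by
      rw [sum_update_eq b f₀ hj, hsum]
    obtain ⟨n₁, hn₁⟩ := Int.eq_ofNat_of_zero_le (hsum₁ ▸ Finset.sum_nonneg hnn : (0 : ℤ) ≤ Nat.find hQ + m)
    have hQ₁ : Q n₁ := ⟨_, hw₁, _, hnn, hpy₁, by rw [hsum₁, hn₁]⟩
    have := Nat.find_min' hQ hQ₁
    omega
  -- descent from `z = p`
  obtain ⟨g, hg, hgy⟩ := exists_smul_eq_of_descent b ha hy (Nat.find hQ) p ⟨1, one_mem _, one_smul _ _⟩ f₀ hf₀ hpy hsum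
  refine ⟨w₀⁻¹ * g, mul_mem (inv_mem hw₀) hg, ?_⟩
  rw [mul_smul, hgy, hydef, inv_smul_smul]

/-- **(b) ⇒ (a), the norm inequality**: if `p ∈ Σ(p)`, every element of `Σ(p)` is conjugate to `p`, and `⟨p, α^∨⟩ = m ≥ 2` for a root `α`,
then `x = p − α ∈ Σ(p)` (`m(p − w x) = (m − 1)(p − wp) + (p − w s_α p) ∈ ℕΔ` and `p − wx ∈ ℤΔ`), so `B(x, x) = B(p, p)`; but
`B(p − α, p − α) = B(p, p) + (1 − m)B(α, α) < B(p, p)`. [cite: Kottwitz1984TwistedOrbital, Lemma 2.3.3 (p. 296)] -/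
theorem false_of_two_le [Fintype ι] {p : M} (hpw : IsWeight P p)
    (hpC : ∀ g ∈ P.weylGroup, p - g • p ∈ AddSubmonoid.closure (P.root '' (b.support : Set ι)))
    (hSig : ∀ x ∈ SigmaSet P b p, ∃ g ∈ P.weylGroup, g • p = x)
    {i : ι} {m : ℤ} (hm : P.coroot' i p = m) (h2 : 2 ≤ m) : False := by
  classical
  obtain ⟨c, hc⟩ : ∃ c : ℕ, m = (c : ℤ) + 1 := ⟨(m - 1).toNat, by omega⟩
  set x := p - P.root i with hxdef
  have hsi : P.reflection i p = p - (c + 1) • P.root i := by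
    rw [reflection_apply, hm, Int.cast_smul_eq_zsmul, hc, ← natCast_zsmul]; push_cast; rfl
  have hxS : x ∈ SigmaSet P b p := by
    refine ⟨fun l => ?_, ?_, fun w => ?_⟩
    · obtain ⟨n, hn⟩ := hpw l
      refine ⟨n - P.pairingIn ℤ i l, ?_⟩
      change P.toLinearMap (p - P.root i) (P.coroot l) = _
      rw [map_sub, LinearMap.sub_apply, hn, root_coroot_eq_pairing, ← P.algebraMap_pairingIn ℤ i l, eq_intCast]
      push_cast; rfl
    · rw [hxdef, sub_sub_cancel]; exact Submodule.subset_span (mem_range_self i)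
    · obtain ⟨g, hg⟩ := w
      change p - g • x ∈ AddSubmonoid.closure (P.root '' (b.support : Set ι))
      -- `(c + 1)(p − g x) = c(p − g p) + (p − g s_i p) ∈ ℕΔ`
      have hkey : (c + 1) • (p - g • x) = c • (p - g • p) + (p - (g * Equiv.reflection P i) • p) := by
        rw [mul_smul, Equiv.reflection_smul, hsi, hxdef, smul_sub g p ((c + 1) • P.root i),
          smul_comm g (c + 1) (P.root i)]
        simp only [add_smul, one_smul, smul_sub]
        abel
      have hmem : (c + 1) • (p - g • x) ∈ AddSubmonoid.closure (P.root '' (b.support : Set ι)) := by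
        rw [hkey]
        exact AddSubmonoid.add_mem _ (AddSubmonoid.nsmul_mem _ (hpC g hg) c)
          (hpC _ (mul_mem hg (P.reflection_mem_weylGroup i)))
      -- `p − g x ∈ ℤΔ`
      have hQ : p - g • x ∈ P.rootSpan ℤ := by
        have h1 : p - g • x = -(g • p - p) + g • P.root i := by rw [hxdef, smul_sub]; abel
        rw [h1]
        refine Submodule.add_mem _ (Submodule.neg_mem _ (smul_sub_mem_rootSpan_int hg hpw)) ?_
        rw [← Equiv.root_indexEquiv_eq_smul]
        exact Submodule.subset_span (mem_range_self _)
      obtain ⟨q, hq⟩ := (mem_rootSpan_int_iff_exists_sum b).mp hQ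
      obtain ⟨f, hf, hfe⟩ := (mem_closure_iff_exists_sum b).mp hmem
      have hcq : (c + 1) • (p - g • x) = ∑ j ∈ b.support, (((c + 1 : ℕ) : ℤ) * q j) • P.root j := by
        rw [hq, ← natCast_zsmul, Finset.smul_sum]
        refine Finset.sum_congr rfl fun j _ => ?_
        rw [smul_smul]
      have hfq := eq_of_sum_eq_sum b (hfe.symm.trans hcq)
      refine (mem_closure_iff_exists_sum b).mpr ⟨q, fun j hj => ?_, hq⟩
      have h0 : 0 ≤ ((c + 1 : ℕ) : ℤ) * q j := hfq j hj ▸ hf j hj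
      push_cast at h0
      nlinarith [h0, c.cast_nonneg (α := ℤ)]
  obtain ⟨g, hg, hgx⟩ := hSig x hxS
  have hB : P.RootForm x x = P.RootForm p p := by rw [← hgx, rootForm_smul_smul hg]
  have hexp : P.RootForm x x = P.RootForm p p - P.RootForm p (P.root i) - P.RootForm (P.root i) p
      + P.RootForm (P.root i) (P.root i) := by
    rw [hxdef]; simp only [map_sub, LinearMap.sub_apply]; abel
  have hsym : P.RootForm (P.root i) p = P.RootForm p (P.root i) := by simp only [rootForm_apply_apply, mul_comm]
  have htwo : 2 * P.RootForm p (P.root i) = (m : R) * P.RootForm (P.root i) (P.root i) := by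
    rw [two_mul_rootForm_root, hm]
  have hA := rootForm_root_self_pos (P := P) i
  have hm2 : (2 : R) ≤ (m : R) := by exact_mod_cast h2
  have := mul_le_mul_of_nonneg_right hm2 hA.le
  linarith

/-- **(b) ⇒ (a)**: if `Σ(p) = W·p` then `⟨p, α^∨⟩ ∈ {−1, 0, 1}` for every root `α` (apply the norm inequality to `α` when `⟨p, α^∨⟩ ≥ 2`
and to `−α` when `⟨p, α^∨⟩ ≤ −2`). [cite: Kottwitz1984TwistedOrbital, Lemma 2.3.3 (p. 296)] -/
theorem forall_coroot'_mem_of_sigmaSet_eq [Fintype ι] {p : M} (hpw : IsWeight P p)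
    (hb : SigmaSet P b p = Set.range fun w : P.weylGroup => w • p) (i : ι) :
    P.coroot' i p ∈ ({-1, 0, 1} : Set R) := by
  have hpS : p ∈ SigmaSet P b p := by rw [hb]; exact ⟨1, one_smul _ _⟩
  have hpC : ∀ g ∈ P.weylGroup, p - g • p ∈ AddSubmonoid.closure (P.root '' (b.support : Set ι)) :=
    fun g hg => hpS.2.2 ⟨g, hg⟩
  have hSig : ∀ x ∈ SigmaSet P b p, ∃ g ∈ P.weylGroup, g • p = x := by
    intro x hx
    rw [hb] at hx
    obtain ⟨w, rfl⟩ := hx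
    exact ⟨w, w.2, rfl⟩
  obtain ⟨m, hm⟩ := hpw i
  change P.coroot' i p = (m : R) at hm
  by_cases h2 : 2 ≤ m
  · exact (false_of_two_le b hpw hpC hSig hm h2).elim
  by_cases h2' : m ≤ -2
  · -- use the root `−α_i`
    have hm' : P.coroot' (P.reflectionPerm i i) p = ((-m : ℤ) : R) := by
      rw [coroot'_reflectionPerm, LinearMap.comp_apply]
      change P.coroot' i (P.reflection i p) = _
      rw [reflection_apply, map_sub, map_smul, hm, root_coroot'_eq_pairing, pairing_same]
      push_cast; ring
    exact (false_of_two_le b hpw hpC hSig hm' (by omega)).elim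
  · simp only [Set.mem_insert_iff, Set.mem_singleton_iff, hm]
    have : m = -1 ∨ m = 0 ∨ m = 1 := by omega
    rcases this with h | h | h <;> simp [h]

end Ordered

end MinusculeLemma

section Discharge

variable (P : RootPairing ι R M N) (b : P.Base) [LinearOrder R] [IsStrictOrderedRing R] [Finite ι] [P.IsCrystallographic] (p : M)

open MinusculeLemma in
/-- **[Kottwitz1984TwistedOrbital, Lemma 2.3.3] (p. 296) HOLDS AS TYPED** — «Let `p ∈ P(R)` be a dominant weight […]. Lemma. The following
conditions on `p` are equivalent: (a) `⟨p, α^∨⟩ = −1, 0, 1` for all `α ∈ R`. (b) `Σ(p) = W·p`.» — for every finite crystallographic root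
pairing `P` over a linearly ordered commutative ring, every base `b` and every dominant weight `p` (discharge of the named fact ★ `Lemma233`).
[cite: Kottwitz1984TwistedOrbital, Lemma 2.3.3 (p. 296)] -/
theorem Lemma233_holds : Lemma233 P b p := by
  intro hpw hp
  cases nonempty_fintype ι
  constructor
  · intro ha
    ext x
    constructor
    · intro hx
      obtain ⟨g, hg, rfl⟩ := exists_smul_eq_of_mem_sigmaSet b ha hx
      exact ⟨⟨g, hg⟩, rfl⟩
    · rintro ⟨w, rfl⟩
      refine ⟨isWeight_smul w.2 hpw, ?_, fun w' => ?_⟩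
      · have h := Submodule.neg_mem _ (smul_sub_mem_rootSpan_int w.2 hpw)
        rwa [neg_sub] at h
      · change p - (w' : Aut P) • ((w : Aut P) • p) ∈ AddSubmonoid.closure (P.root '' (b.support : Set ι))
        rw [← mul_smul]
        exact sub_smul_mem_closure_of_minuscule b hp ha (mul_mem w'.2 w.2)
  · intro hb i
    exact forall_coroot'_mem_of_sigmaSet_eq b hpw hb i

end Discharge

end Literature.NumberTheory.Kottwitz1984TwistedOrbital.SatakeTransform
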